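import Mathlib.MeasureTheory.Integral.IntervalIntegral.Basic
import Mathlib.Analysis.Complex.Basic
import Mathlib.Tactic.Linarith
import Mathlib.Tactic.Positivity
import Mathlib.Tactic.FieldSimp
import Mathlib.Analysis.Real.Pi.Bounds
import Summits.NavierStokesRegularity.TurbBounds.ShearReductions
import HarnessLib

/-!
# Wavenumber cutoffs of the shear certificates at the integrand and integral level
# (FW16 (2.17)–(2.18) for the stress-driven layer; lemma R-SC for plane Couette in the RZG25 formulation)

Cell `turb-bounds` (pub-turb), shear lane (pub-turb-shear gen 5, 2026-08-21), T12a class ("pen-and-paper chains as small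
theorems"). Files of record: `code/rbsdp/SPEC.md` §2.9 (CUTOFF LEMMA), `CERT-SHEAR.md` §1 and §3 (lemma R-SC), Fantuzzi–Wynn,
Phys. Rev. E 93 (2016) 043308 = arXiv:1512.05615, eqs. (2.17)–(2.18) [held text p0005]: "𝒬_mn ≥ ∫ (α_m² + β_n² − 2‖dφ/dζ‖_∞) ‖U_mn‖² dζ,
hence only the finitely many wavenumbers with α_m² + β_n² ≤ 2‖dφ/dζ‖_∞ need to be considered"; Rajkotia-Zaheer–Goluskin,
arXiv:2503.04005 §2 / App. A (per-wavevector spectral constraint of plane Couette flow).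

WHAT IS HERE (no fluid mechanics; the identification of the per-mode PDE forms with the integrands below is the cited reduction,
refereed prose of the paper's Appendix A — not proved here). Both cutoffs are instances of ONE elementary fact about a
"pair form": for amplitudes `u, v : ℝ → ℂ` on an interval `[a, b]`, a diagonal weight `D`, a real coupling coefficient `κ(x)` with
`|κ| ≤ 2L`, and `e ≥ 0` collecting every other non-negative term of the form,
  `∫ [e + D(‖u‖² + ‖v‖²) + κ·Re(u·conj v)] ≥ (D − L) ∫ (‖u‖² + ‖v‖²)`, hence `≥ 0` as soon as `L ≤ D`.
* General: `pair_coupling_abs_le`, `pair_integrand_lower`, `pair_integral_lower_of_integrable` (integrable data, no continuity),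
  `pair_integral_lower` (continuous data), `pair_form_nonneg`.
* FW16 stress-driven layer (ζ ∈ [−1, 1]; `κ = 4φ′`, `|φ′| ≤ T`, `L = 2T`, `D = α² = α_m² + β_n²`): `coupling_abs_le`, `integrand_lower`,
  `integral_lower` (= (2.17)), `mode_free` (= (2.18): `2T ≤ α²` ⇒ the form is ≥ 0 for ALL continuous U, W), and the link to the
  certificates' exact scalar line `Certs/<Row>/Scalars.cutoff : Γx²·T ≤ 2π²·(m_cert+1)²` (T = ‖φ̂‖₁ ≥ ‖dφ/dζ‖_∞, rbsdp SPEC 2.1/2.9):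
  `two_T_le_alpha_sq`, `modes_free_beyond`, `modes_free_nat` — every 2-D mode m ≥ m_cert + 1 (α_m = 2πm/Γx) is free.
* Plane Couette, RZG25 streamwise-invariant form after x = 2z (CERT-SHEAR §3: coupling `2g·w₁w₃` with `|g| ≤ G = ‖ĝ‖₁`, diagonal
  `c·K` with `c = a − 1 > 0`, `K = k²` for the spanwise wavenumber k = m at Γ_y = 2π; for an oblique wavevector the same inequality with
  `K = (2πj/Γx)² + k²` is the scalar step of lemma R-SC — that the oblique constraint reduces to this shape is R-SC's refereed prose):
  `couette_integral_lower`, `couette_mode_free` (`G ≤ c·K` ⇒ form ≥ 0: lemma R-SC's "free wavevector"), and the link to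
  `Certs/C…/Scalars.cutoff : T ≤ c·(m_cert+1)²`: `couette_modes_free_nat` — every spanwise mode k ≥ m_cert + 1 is free
  (`couette_oblique_free`: and every K ≥ such a k²).
* Rational wavenumber constants of the fw16 family (rbsdp SPEC 2.2, the cell's π-enclosure `π_lo = 4272943/1360120 < π < π_hi =
  5419351/1725033` from `Real.pi_gt_d20` / `Real.pi_lt_d20`): `piLo_lt_pi`, `pi_lt_piHi`, and for `α_m = 2πm/Γx` the three safe-side inequalities
  `Am_le : 4Γx²/(π_hi² m²) ≤ 16/α_m²`, `Cm_le : 4π_lo² m²/Γx² ≤ α_m²`, `Dm_ge : 8/α_m ≤ 4Γx/(π_lo m)` — exactly the hypotheses `hA`, `hC`, `hD` of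
  `ShearReductions.fw16_rational_relaxation`, discharged once for every mode (`fw16_relaxation_cell`): SPEC 2.2's 3-line lemma is then
  kernel-checked end to end at the level of named norms.
The scalar cores already in the tree (`ShearReductions.wavevector_cutoff/_free`, `Cutoff.quad_core`, `fw16_rational_relaxation`) are the same
inequalities with the norms named as real numbers; this file adds the pointwise-to-integral step and the constants.
HONEST FRAMING: rigorous bounds for the stated PDE and boundary conditions; no claim about physical turbulence beyond the bound.
-/

namespace Summit.NavierStokesRegularity.TurbBounds.ShearCutoff

open scoped ComplexConjugate
open intervalIntegral

/-! ### The general pair form -/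

/-- AM–GM bound on an indefinite coupling term: `|κ·Re(u·conj v)| ≤ L(‖u‖² + ‖v‖²)` when `|κ| ≤ 2L`. -/
theorem pair_coupling_abs_le {L κ : ℝ} (hκ : |κ| ≤ 2 * L) (u v : ℂ) :
    |κ * (u * conj v).re| ≤ L * (‖u‖ ^ 2 + ‖v‖ ^ 2) := by
  have hre : |(u * conj v).re| ≤ ‖u‖ * ‖v‖ := by
    calc |(u * conj v).re| ≤ ‖u * conj v‖ := Complex.abs_re_le_norm _
      _ = ‖u‖ * ‖v‖ := by rw [norm_mul, Complex.norm_conj]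
  have hL : 0 ≤ 2 * L := le_trans (abs_nonneg _) hκ
  have h2 : 2 * (‖u‖ * ‖v‖) ≤ ‖u‖ ^ 2 + ‖v‖ ^ 2 := by nlinarith [sq_nonneg (‖u‖ - ‖v‖)]
  have hprod : |κ| * |(u * conj v).re| ≤ 2 * L * (‖u‖ * ‖v‖) := mul_le_mul hκ hre (abs_nonneg _) hL
  calc |κ * (u * conj v).re| = |κ| * |(u * conj v).re| := abs_mul _ _
    _ ≤ 2 * L * (‖u‖ * ‖v‖) := hprod
    _ = L * (2 * (‖u‖ * ‖v‖)) := by ring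
    _ ≤ L * (‖u‖ ^ 2 + ‖v‖ ^ 2) := mul_le_mul_of_nonneg_left h2 (by linarith)

/-- Pointwise lower bound of the pair form: with `e ≥ 0` and `|κ| ≤ 2L`,
`(D − L)(‖u‖² + ‖v‖²) ≤ e + D(‖u‖² + ‖v‖²) + κ·Re(u·conj v)`. -/
theorem pair_integrand_lower {D L κ e : ℝ} (he : 0 ≤ e) (hκ : |κ| ≤ 2 * L) (u v : ℂ) :
    (D - L) * (‖u‖ ^ 2 + ‖v‖ ^ 2) ≤ e + D * (‖u‖ ^ 2 + ‖v‖ ^ 2) + κ * (u * conj v).re := by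
  have h := pair_coupling_abs_le hκ u v
  have h' : -(L * (‖u‖ ^ 2 + ‖v‖ ^ 2)) ≤ κ * (u * conj v).re := by
    have := neg_abs_le (κ * (u * conj v).re); linarith
  linarith

/-- The pair form integrated over `[a, b]`, integrable data (the most general form; no continuity assumed):
`(D − L) ∫ (‖u‖² + ‖v‖²) ≤ ∫ [e + D(‖u‖² + ‖v‖²) + κ·Re(u·conj v)]`. -/
theorem pair_integral_lower_of_integrable {a b D L : ℝ} (hab : a ≤ b) {κ e : ℝ → ℝ} {u v : ℝ → ℂ}
    (hI₁ : IntervalIntegrable (fun x => ‖u x‖ ^ 2 + ‖v x‖ ^ 2) MeasureTheory.volume a b)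
    (hI₂ : IntervalIntegrable (fun x => e x + D * (‖u x‖ ^ 2 + ‖v x‖ ^ 2) + κ x * (u x * conj (v x)).re)
      MeasureTheory.volume a b)
    (he : ∀ x ∈ Set.Icc a b, 0 ≤ e x) (hκ : ∀ x ∈ Set.Icc a b, |κ x| ≤ 2 * L) :
    (D - L) * ∫ x in a..b, (‖u x‖ ^ 2 + ‖v x‖ ^ 2) ≤
      ∫ x in a..b, (e x + D * (‖u x‖ ^ 2 + ‖v x‖ ^ 2) + κ x * (u x * conj (v x)).re) := by
  rw [← intervalIntegral.integral_const_mul]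
  exact intervalIntegral.integral_mono_on hab (hI₁.const_mul _) hI₂
    fun x hx => pair_integrand_lower (he x hx) (hκ x hx) (u x) (v x)

/-- The pair form integrated over `[a, b]` for continuous data:
`(D − L) ∫ (‖u‖² + ‖v‖²) ≤ ∫ [e + D(‖u‖² + ‖v‖²) + κ·Re(u·conj v)]`. -/
theorem pair_integral_lower {a b D L : ℝ} (hab : a ≤ b) {κ e : ℝ → ℝ} {u v : ℝ → ℂ} (hu : Continuous u)
    (hv : Continuous v) (hκc : Continuous κ) (hec : Continuous e) (he : ∀ x ∈ Set.Icc a b, 0 ≤ e x)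
    (hκ : ∀ x ∈ Set.Icc a b, |κ x| ≤ 2 * L) :
    (D - L) * ∫ x in a..b, (‖u x‖ ^ 2 + ‖v x‖ ^ 2) ≤
      ∫ x in a..b, (e x + D * (‖u x‖ ^ 2 + ‖v x‖ ^ 2) + κ x * (u x * conj (v x)).re) := by
  have hn : Continuous fun x => ‖u x‖ ^ 2 + ‖v x‖ ^ 2 := by fun_prop
  have hre : Continuous fun x => (u x * conj (v x)).re :=
    Complex.continuous_re.comp (hu.mul (Complex.continuous_conj.comp hv))
  exact pair_integral_lower_of_integrable (D := D) hab (hn.intervalIntegrable _ _)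
    (((hec.add (continuous_const.mul hn)).add (hκc.mul hre)).intervalIntegrable _ _) he hκ

/-- **Free wavevector.** If `L ≤ D` the pair form is non-negative for every continuous `u, v`. -/
theorem pair_form_nonneg {a b D L : ℝ} (hab : a ≤ b) {κ e : ℝ → ℝ} {u v : ℝ → ℂ} (hu : Continuous u)
    (hv : Continuous v) (hκc : Continuous κ) (hec : Continuous e) (he : ∀ x ∈ Set.Icc a b, 0 ≤ e x)
    (hκ : ∀ x ∈ Set.Icc a b, |κ x| ≤ 2 * L) (hcut : L ≤ D) :
    0 ≤ ∫ x in a..b, (e x + D * (‖u x‖ ^ 2 + ‖v x‖ ^ 2) + κ x * (u x * conj (v x)).re) := by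
  have h := pair_integral_lower (D := D) hab hu hv hκc hec he hκ
  have hI : 0 ≤ ∫ x in a..b, (‖u x‖ ^ 2 + ‖v x‖ ^ 2) :=
    intervalIntegral.integral_nonneg hab fun x _ => by positivity
  have : 0 ≤ (D - L) * ∫ x in a..b, (‖u x‖ ^ 2 + ‖v x‖ ^ 2) := mul_nonneg (by linarith) hI
  linarith

/-! ### FW16 stress-driven shear layer (ζ ∈ [−1, 1]; coupling `4φ′·Re(U·conj W)`, `|φ′| ≤ T`; diagonal `α²`) -/

/-- AM–GM bound on FW16's coupling term: `|4 φ′ Re(U·conj W)| ≤ 2T(‖U‖² + ‖W‖²)` when `|φ′| ≤ T`. -/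
theorem coupling_abs_le {T φ' : ℝ} (hφ : |φ'| ≤ T) (U W : ℂ) :
    |4 * φ' * (U * conj W).re| ≤ 2 * T * (‖U‖ ^ 2 + ‖W‖ ^ 2) := by
  have hκ : |4 * φ'| ≤ 2 * (2 * T) := by rw [abs_mul]; norm_num; linarith
  exact pair_coupling_abs_le hκ U W

/-- **FW16 (2.17), pointwise.** With `e ≥ 0` (the dropped non-negative part of `‖𝒟U‖²`) and `|φ′| ≤ T`, the integrand of the
per-mode spectral form is at least `(α² − 2T)(‖U‖² + ‖W‖²)`. -/
theorem integrand_lower {α T φ' e : ℝ} (he : 0 ≤ e) (hφ : |φ'| ≤ T) (U W : ℂ) :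
    (α ^ 2 - 2 * T) * (‖U‖ ^ 2 + ‖W‖ ^ 2) ≤
      e + α ^ 2 * (‖U‖ ^ 2 + ‖W‖ ^ 2) + 4 * φ' * (U * conj W).re := by
  have hκ : |4 * φ'| ≤ 2 * (2 * T) := by rw [abs_mul]; norm_num; linarith
  exact pair_integrand_lower he hκ U W

/-- **FW16 (2.17), integrated over ζ ∈ [−1, 1]** for continuous data:
`(α² − 2T) ∫ (‖U‖² + ‖W‖²) ≤ ∫ [e + α²(‖U‖² + ‖W‖²) + 4 φ′ Re(U conj W)]`. -/
theorem integral_lower {α T : ℝ} {φ' e : ℝ → ℝ} {U W : ℝ → ℂ} (hU : Continuous U) (hW : Continuous W)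
    (hφc : Continuous φ') (hec : Continuous e) (he : ∀ ζ ∈ Set.Icc (-1 : ℝ) 1, 0 ≤ e ζ)
    (hφ : ∀ ζ ∈ Set.Icc (-1 : ℝ) 1, |φ' ζ| ≤ T) :
    (α ^ 2 - 2 * T) * ∫ ζ in (-1 : ℝ)..1, (‖U ζ‖ ^ 2 + ‖W ζ‖ ^ 2) ≤
      ∫ ζ in (-1 : ℝ)..1, (e ζ + α ^ 2 * (‖U ζ‖ ^ 2 + ‖W ζ‖ ^ 2) + (4 * φ' ζ) * (U ζ * conj (W ζ)).re) := by
  have hκ : ∀ ζ ∈ Set.Icc (-1 : ℝ) 1, |4 * φ' ζ| ≤ 2 * (2 * T) := fun ζ hζ => by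
    rw [abs_mul]; norm_num; linarith [hφ ζ hζ]
  exact pair_integral_lower (D := α ^ 2) (by norm_num) hU hW (continuous_const.mul hφc) hec he hκ

/-- **FW16 (2.18): modes beyond the cutoff are free.** If `2T ≤ α²` then the per-mode form is non-negative for every continuous
`U, W` (no LMI is needed for this mode). -/
theorem mode_free {α T : ℝ} {φ' e : ℝ → ℝ} {U W : ℝ → ℂ} (hU : Continuous U) (hW : Continuous W)
    (hφc : Continuous φ') (hec : Continuous e) (he : ∀ ζ ∈ Set.Icc (-1 : ℝ) 1, 0 ≤ e ζ)
    (hφ : ∀ ζ ∈ Set.Icc (-1 : ℝ) 1, |φ' ζ| ≤ T) (hcut : 2 * T ≤ α ^ 2) :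
    0 ≤ ∫ ζ in (-1 : ℝ)..1, (e ζ + α ^ 2 * (‖U ζ‖ ^ 2 + ‖W ζ‖ ^ 2) + (4 * φ' ζ) * (U ζ * conj (W ζ)).re) := by
  have hκ : ∀ ζ ∈ Set.Icc (-1 : ℝ) 1, |4 * φ' ζ| ≤ 2 * (2 * T) := fun ζ hζ => by
    rw [abs_mul]; norm_num; linarith [hφ ζ hζ]
  exact pair_form_nonneg (D := α ^ 2) (by norm_num) hU hW (continuous_const.mul hφc) hec he hκ hcut

/-- Link to the certificates' exact cutoff line (`Certs/<Row>/Scalars.cutoff`, rbsdp SPEC 2.9): `Γx² T ≤ 2π² m²` gives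
`2T ≤ α_m²` for the 2-D wavenumber `α_m = 2πm/Γx`. -/
theorem two_T_le_alpha_sq {Gx T m : ℝ} (hGx : 0 < Gx) (h : Gx ^ 2 * T ≤ 2 * Real.pi ^ 2 * m ^ 2) :
    2 * T ≤ (2 * Real.pi * m / Gx) ^ 2 := by
  have hGx2 : 0 < Gx ^ 2 := by positivity
  rw [div_pow, le_div_iff₀ hGx2]
  nlinarith

/-- All modes beyond the cutoff are free at once: if the cutoff line holds at `m₀ ≥ 0` then `2T ≤ α_m²` for every `m ≥ m₀`. -/
theorem modes_free_beyond {Gx T m₀ : ℝ} (hGx : 0 < Gx) (hm₀ : 0 ≤ m₀) (h : Gx ^ 2 * T ≤ 2 * Real.pi ^ 2 * m₀ ^ 2)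
    {m : ℝ} (hm : m₀ ≤ m) : 2 * T ≤ (2 * Real.pi * m / Gx) ^ 2 := by
  apply two_T_le_alpha_sq hGx
  have hmm : m₀ ^ 2 ≤ m ^ 2 := by nlinarith
  have hpi : 0 ≤ 2 * Real.pi ^ 2 := by positivity
  exact le_trans h (mul_le_mul_of_nonneg_left hmm hpi)

/-- The same in the natural-number form of the certificates' scalar files (`Certs/<Row>/Scalars.cutoff :
Γx² · T ≤ 2π² · (m_cert + 1)²`): every 2-D mode `m ≥ m_cert + 1` is free. -/
theorem modes_free_nat {Gx T : ℝ} {mCert : ℕ} (hGx : 0 < Gx)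
    (h : Gx ^ 2 * T ≤ 2 * Real.pi ^ 2 * ((mCert : ℝ) + 1) ^ 2) {m : ℕ} (hm : mCert + 1 ≤ m) :
    2 * T ≤ (2 * Real.pi * (m : ℝ) / Gx) ^ 2 := by
  have hm' : ((mCert : ℝ) + 1) ≤ (m : ℝ) := by exact_mod_cast hm
  exact modes_free_beyond hGx (by positivity) h hm'

/-! ### Plane Couette flow, RZG25 streamwise-invariant form (x ∈ [−1, 1]; coupling `2g·Re(w₁·conj w₃)`, `|g| ≤ G`; diagonal `c·K`) -/

/-- **Lemma R-SC at the integral level.** With `e ≥ 0` (the dropped non-negative derivative terms), `|g| ≤ G` on `[−1, 1]`: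
`(cK − G) ∫ (‖w₁‖² + ‖w₃‖²) ≤ ∫ [e + cK(‖w₁‖² + ‖w₃‖²) + 2g·Re(w₁·conj w₃)]`. -/
theorem couette_integral_lower {c K G : ℝ} {g e : ℝ → ℝ} {w₁ w₃ : ℝ → ℂ} (h₁ : Continuous w₁) (h₃ : Continuous w₃)
    (hgc : Continuous g) (hec : Continuous e) (he : ∀ x ∈ Set.Icc (-1 : ℝ) 1, 0 ≤ e x)
    (hg : ∀ x ∈ Set.Icc (-1 : ℝ) 1, |g x| ≤ G) :
    (c * K - G) * ∫ x in (-1 : ℝ)..1, (‖w₁ x‖ ^ 2 + ‖w₃ x‖ ^ 2) ≤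
      ∫ x in (-1 : ℝ)..1, (e x + c * K * (‖w₁ x‖ ^ 2 + ‖w₃ x‖ ^ 2) + (2 * g x) * (w₁ x * conj (w₃ x)).re) := by
  have hκ : ∀ x ∈ Set.Icc (-1 : ℝ) 1, |2 * g x| ≤ 2 * G := fun x hx => by
    rw [abs_mul]; norm_num; exact hg x hx
  exact pair_integral_lower (D := c * K) (by norm_num) h₁ h₃ (continuous_const.mul hgc) hec he hκ

/-- **Free wavevector (lemma R-SC): if `G ≤ c·K` the per-wavevector Couette form is non-negative for every continuous `w₁, w₃`.** -/
theorem couette_mode_free {c K G : ℝ} {g e : ℝ → ℝ} {w₁ w₃ : ℝ → ℂ} (h₁ : Continuous w₁) (h₃ : Continuous w₃)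
    (hgc : Continuous g) (hec : Continuous e) (he : ∀ x ∈ Set.Icc (-1 : ℝ) 1, 0 ≤ e x)
    (hg : ∀ x ∈ Set.Icc (-1 : ℝ) 1, |g x| ≤ G) (hcut : G ≤ c * K) :
    0 ≤ ∫ x in (-1 : ℝ)..1, (e x + c * K * (‖w₁ x‖ ^ 2 + ‖w₃ x‖ ^ 2) + (2 * g x) * (w₁ x * conj (w₃ x)).re) := by
  have hκ : ∀ x ∈ Set.Icc (-1 : ℝ) 1, |2 * g x| ≤ 2 * G := fun x hx => by
    rw [abs_mul]; norm_num; exact hg x hx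
  exact pair_form_nonneg (D := c * K) (by norm_num) h₁ h₃ (continuous_const.mul hgc) hec he hκ hcut

/-- Link to the Couette certificates' exact cutoff line (`Certs/C…/Scalars.cutoff : T ≤ c·(m_cert + 1)²`, T = ‖ĝ‖₁, spanwise
wavenumber k = m at Γ_y = 2π, K = k²): with `0 ≤ c`, every spanwise mode `k ≥ m_cert + 1` has `T ≤ c·k²` (and a fortiori every oblique
wavevector with `K ≥ k²`). -/
theorem couette_modes_free_nat {c T : ℝ} {mCert : ℕ} (hc : 0 ≤ c) (h : T ≤ c * ((mCert : ℝ) + 1) ^ 2) {k : ℕ}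
    (hk : mCert + 1 ≤ k) : T ≤ c * (k : ℝ) ^ 2 := by
  have hk' : ((mCert : ℝ) + 1) ≤ (k : ℝ) := by exact_mod_cast hk
  have hsq : ((mCert : ℝ) + 1) ^ 2 ≤ (k : ℝ) ^ 2 := by nlinarith [hk', Nat.cast_nonneg (α := ℝ) mCert]
  exact le_trans h (mul_le_mul_of_nonneg_left hsq hc)

/-- … and for an oblique wavevector: `T ≤ c·k²` and `k² ≤ K` give `T ≤ c·K`. -/
theorem couette_oblique_free {c T k2 K : ℝ} (hc : 0 ≤ c) (h : T ≤ c * k2) (hK : k2 ≤ K) : T ≤ c * K :=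
  le_trans h (mul_le_mul_of_nonneg_left hK hc)

/-! ### Rational wavenumber constants of the fw16 family (rbsdp SPEC 2.2) -/

/-- The cell's rational lower enclosure of π: `4272943/1360120 < π` (from Mathlib's 20-digit bound). -/
theorem piLo_lt_pi : (4272943 : ℝ) / 1360120 < Real.pi := by
  have h := Real.pi_gt_d20
  have h2 : (4272943 : ℝ) / 1360120 ≤ 3.14159265358979323846 := by norm_num
  exact lt_of_le_of_lt h2 h

/-- The cell's rational upper enclosure of π: `π < 5419351/1725033` (from Mathlib's 20-digit bound). -/
theorem pi_lt_piHi : Real.pi < (5419351 : ℝ) / 1725033 := by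
  have h := Real.pi_lt_d20
  have h2 : (3.14159265358979323847 : ℝ) ≤ (5419351 : ℝ) / 1725033 := by norm_num
  exact lt_of_lt_of_le h h2

/-- SPEC 2.2 (a): `A_m := 4Γx²/(π_hi² m²) ≤ 16/α_m²` for `α_m = 2πm/Γx`, whenever `π ≤ π_hi`. -/
theorem Am_le {Gx m piHi : ℝ} (hGx : 0 < Gx) (hm : 0 < m) (hpi : Real.pi ≤ piHi) :
    4 * Gx ^ 2 / (piHi ^ 2 * m ^ 2) ≤ 16 / (2 * Real.pi * m / Gx) ^ 2 := by
  have hπ : 0 < Real.pi := Real.pi_pos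
  have hrhs : 16 / (2 * Real.pi * m / Gx) ^ 2 = 4 * Gx ^ 2 / (Real.pi ^ 2 * m ^ 2) := by
    field_simp
    ring
  rw [hrhs]
  apply div_le_div_of_nonneg_left (by positivity) (by positivity)
  have : Real.pi ^ 2 ≤ piHi ^ 2 := pow_le_pow_left₀ hπ.le hpi 2
  nlinarith [sq_nonneg m]

/-- SPEC 2.2 (b): `C_m := 4π_lo² m²/Γx² ≤ α_m²` whenever `0 ≤ π_lo ≤ π`. -/
theorem Cm_le {Gx m piLo : ℝ} (hGx : 0 < Gx) (hlo : 0 ≤ piLo) (hpi : piLo ≤ Real.pi) :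
    4 * piLo ^ 2 * m ^ 2 / Gx ^ 2 ≤ (2 * Real.pi * m / Gx) ^ 2 := by
  have hsq : piLo ^ 2 ≤ Real.pi ^ 2 := pow_le_pow_left₀ hlo hpi 2
  have hrhs : (2 * Real.pi * m / Gx) ^ 2 = 4 * Real.pi ^ 2 * m ^ 2 / Gx ^ 2 := by
    field_simp
    ring
  rw [hrhs]
  apply div_le_div_of_nonneg_right _ (by positivity)
  nlinarith [sq_nonneg m]

/-- SPEC 2.2 (c): `8/α_m ≤ D_m := 4Γx/(π_lo m)` whenever `0 < π_lo ≤ π`. -/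
theorem Dm_ge {Gx m piLo : ℝ} (hGx : 0 < Gx) (hm : 0 < m) (hlo : 0 < piLo) (hpi : piLo ≤ Real.pi) :
    8 / (2 * Real.pi * m / Gx) ≤ 4 * Gx / (piLo * m) := by
  have hπ : 0 < Real.pi := Real.pi_pos
  have hlhs : 8 / (2 * Real.pi * m / Gx) = 4 * Gx / (Real.pi * m) := by
    field_simp
    ring
  rw [hlhs]
  apply div_le_div_of_nonneg_left (by positivity) (by positivity)
  nlinarith

/-- **SPEC 2.2 for the cell's constants, end to end.** For every mode (`Γx > 0`, `m > 0`) and every fixed test function (norms `p, q, r ≥ 0`,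
indefinite term `X`): if the RELAXED form with the cell's rational constants `A_m = 4Γx²/(π_hi² m²)`, `C_m = 4π_lo² m²/Γx²`,
`D_m = 4Γx/(π_lo m)` is non-negative, then FW16's form with `16/α², α², 8/α` is non-negative (`ShearReductions.fw16_rational_relaxation`
with its three hypotheses discharged by `Am_le`, `Cm_le`, `Dm_ge`). -/
theorem fw16_relaxation_cell {Gx m p q r X : ℝ} (hGx : 0 < Gx) (hm : 0 < m) (hp : 0 ≤ p) (hq : 0 ≤ q) (hr : 0 ≤ r)
    (hG : 0 ≤ 4 * Gx ^ 2 / (((5419351 : ℝ) / 1725033) ^ 2 * m ^ 2) * p + 8 * q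
      + 4 * ((4272943 : ℝ) / 1360120) ^ 2 * m ^ 2 / Gx ^ 2 * r - 4 * Gx / (((4272943 : ℝ) / 1360120) * m) * X) :
    0 ≤ 16 / (2 * Real.pi * m / Gx) ^ 2 * p + 8 * q + (2 * Real.pi * m / Gx) ^ 2 * r - 8 / (2 * Real.pi * m / Gx) * X := by
  have hα : 0 < 2 * Real.pi * m / Gx := by positivity
  have hlo : (0 : ℝ) < (4272943 : ℝ) / 1360120 := by norm_num
  exact fw16_rational_relaxation hα (Am_le hGx hm pi_lt_piHi.le) (Cm_le hGx hlo.le piLo_lt_pi.le)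
    (Dm_ge hGx hm hlo piLo_lt_pi.le) hp hq hr hG

end Summit.NavierStokesRegularity.TurbBounds.ShearCutoff
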